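import Summits.AtomisticToContinuum.BoseEinsteinCondensation.Theorems.BECThomsonPrincipleGaussianDominationCanDefs
import Summits.AtomisticToContinuum.BoseEinsteinCondensation.Theorems.BECConjugateDominationNearMinimiserStabilityHelpers
import Literature.MathematicalPhysics.QuantumManyBody.OneBodyCurrentGain
import Mathlib.Analysis.Calculus.MeanValue
import HarnessLib

/-!
# Route `BECThomsonPrinciple`, crux `GaussianDominationCan` (stmt-AtomisticToContinuum-9479),
# line `coupling-monotone-chord` — stub C `stub_chordTransport` (chord transport along the ray)

Proves the registered stub `stub_chordTransport : ChordTransport` (vocabulary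
`Theorems/BECThomsonPrincipleGaussianDominationCanDefs.lean`) by the variational Hellmann–Feynman
argument, with no spectral theory.  §Ray is pure real analysis on an arbitrary type of states (the
functions `F, e, g` are passed with their defining equations): `e(s', τ) = inf_Φ [t + τ⁺W - s'J]` is
non-decreasing and `Wmax`-Lipschitz in `τ ≥ 0`; the one-step bounds `e(τ+h) ≤ e(τ) + δ + h g(δ, τ)`
(test a `δ`-near-minimiser) and `e(τ) + h g(δ, τ) ≤ e(τ+h)` if `h g ≤ δ` (a state is `δ`-near-minimal
or pays `δ`) turn the sign `⨆_δ g(0, δ, τ) ≤ ⨆_δ g(s, δ, τ)` into a non-positive lower right Dini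
derivative of `D = e(0, ·) - e(s, ·)` (`δ := h²`), whence `D(1) ≤ D(ε) → D(0)`
(`image_le_of_liminf_slope_right_le_deriv_boundary`).  §Concrete: for bounded admissible `w` all
energies are finite and `W_w ≤ Wmax` (`exists_bound_periodizedPotential`), the ray is affine
`E_{τ•w} = E_0 + τ W_w`, the free chord bounds the sourced functional below,
`groundInteraction (τ•w) s = τ ⨆_δ g(s, δ, τ)`, and the ends `e(0, 1) = E₀(w)`, `e(0, 0) = E₀(0)` give
`GDIneq w`.  Reference: W. Thirring, *Quantum Mathematical Physics* §3.5 (Feynman–Hellmann).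
-/

noncomputable section

namespace Summit.AtomisticToContinuum.BoseEinsteinCondensation.Cruxes.GaussianDominationCan.CouplingMonotoneChord

open MeasureTheory Set Filter Topology
open scoped ENNReal NNReal
open Literature.MathematicalPhysics.QuantumManyBody.BoseGas
open Summit.AtomisticToContinuum.BoseEinsteinCondensation.Theorems (exists_bound_periodizedPotential)
open Summit.AtomisticToContinuum.BoseEinsteinCondensation.Theorems.GaussianDominationCan.Negative
  (GDIneq sourceIntegral periodicInteraction_zero constState)

/-! ### §Ray: variational Hellmann–Feynman along a coupling ray (abstract) -/

section Ray

variable {S : Type*} [Nonempty S] {t J : S → ℝ} {W : S → ℝ≥0∞} {Wm : ℝ} {F : ℝ → ℝ → S → ℝ}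
  {e : ℝ → ℝ → ℝ} {g : ℝ → ℝ → ℝ → ℝ≥0∞} {b : ℝ → ℝ} {s' : ℝ}
  (hWle : ∀ Φ, W Φ ≤ ENNReal.ofReal Wm) (hWm : 0 ≤ Wm)
  (hF : ∀ τ s' Φ, F τ s' Φ = t Φ + max τ 0 * (W Φ).toReal - s' * J Φ)
  (he : ∀ s' τ, e s' τ = ⨅ Φ, F τ s' Φ)
  (hg : ∀ s' δ τ, g s' δ τ = ⨅ (Φ : S) (_ : F τ s' Φ ≤ e s' τ + δ), W Φ)
  (hb : ∀ s' τ Φ, b s' ≤ F τ s' Φ)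

include he
/-- A common lower bound of `F(τ, s', ·)` is below `e(s', τ) = inf_Φ F(τ, s', Φ)`. [folklore] -/
theorem ray_le_e {τ c : ℝ} (h : ∀ Φ, c ≤ F τ s' Φ) : c ≤ e s' τ := by
  rw [he]; exact le_ciInf h

/-- The infimum `e(s', τ)` is approached. [folklore] -/
theorem ray_exists_lt {τ ε : ℝ} (hε : 0 < ε) : ∃ Φ, F τ s' Φ < e s' τ + ε :=
  exists_lt_of_ciInf_lt (by rw [← he]; linarith)

include hb
omit [Nonempty S] in
/-- `e(s', τ) ≤ F(τ, s', Φ)` (the family is bounded below). [folklore] -/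
theorem ray_e_le (τ : ℝ) (Φ : S) : e s' τ ≤ F τ s' Φ := by
  rw [he]; exact ciInf_le ⟨b s', by rintro _ ⟨Ψ, rfl⟩; exact hb s' τ Ψ⟩ Φ

include hF
/-- `τ ↦ e(s', τ)` is non-decreasing (`W ≥ 0`). [folklore] -/
theorem ray_e_mono {τ τ' : ℝ} (hττ' : τ ≤ τ') : e s' τ ≤ e s' τ' := by
  refine ray_le_e he fun Φ => (ray_e_le he hb τ Φ).trans ?_
  rw [hF, hF]
  nlinarith [mul_le_mul_of_nonneg_right (max_le_max hττ' (le_refl (0 : ℝ)))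
    (ENNReal.toReal_nonneg (a := W Φ))]

include hWle hWm
/-- `τ ↦ e(s', τ)` grows with slope at most `Wmax` on `[0, ∞)`. [folklore] -/
theorem ray_e_le_add {τ τ' : ℝ} (hτ : 0 ≤ τ) (hττ' : τ ≤ τ') : e s' τ' ≤ e s' τ + (τ' - τ) * Wm := by
  suffices h : e s' τ' - (τ' - τ) * Wm ≤ e s' τ by linarith
  refine ray_le_e he fun Φ => ?_
  have h1 := ray_e_le he hb (s' := s') τ' Φ
  have h2 : (W Φ).toReal ≤ Wm := ENNReal.toReal_le_of_le_ofReal hWm (hWle Φ)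
  rw [hF, max_eq_left (hτ.trans hττ')] at h1
  rw [hF, max_eq_left hτ]
  nlinarith [mul_nonneg (sub_nonneg.2 hττ') (sub_nonneg.2 h2)]

/-- `τ ↦ e(s', τ)` is (`Wmax`-Lipschitz) continuous on `[0, ∞)`. [folklore] -/
theorem ray_continuousOn (s' : ℝ) : ContinuousOn (e s') (Ici 0) := by
  refine (LipschitzOnWith.of_le_add_mul Wm.toNNReal fun x hx y hy => ?_).continuousOn
  rw [Real.coe_toNNReal _ hWm, Real.dist_eq]
  rcases le_total x y with hxy | hxy
  · have h1 := ray_e_mono hF he hb (s' := s') hxy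
    nlinarith [abs_nonneg (x - y)]
  · have h1 := ray_e_le_add hWle hWm hF he hb (s' := s') hy hxy
    rw [abs_of_nonneg (sub_nonneg.2 hxy)]
    linarith

include hg
omit hWm hF hb in
/-- The least interaction of `δ`-near-minimisers, `g(s', δ, τ)`, is at most `Wmax`. [folklore] -/
theorem ray_g_le {τ δ : ℝ} (hδ : 0 < δ) : g s' δ τ ≤ ENNReal.ofReal Wm := by
  obtain ⟨Φ, hΦ⟩ := ray_exists_lt he (s' := s') (τ := τ) hδ
  exact hg s' δ τ ▸ (iInf₂_le Φ hΦ.le).trans (hWle Φ)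

omit hWm in
/-- UPPER one-step bound `e(τ + h) ≤ e(τ) + δ + h g(δ, τ)` (test a `δ`-near-minimiser at `τ + h`).
[folklore] -/
theorem ray_upper_step {τ h δ : ℝ} (hτ : 0 ≤ τ) (hh : 0 < h) (hδ : 0 < δ) :
    e s' (τ + h) ≤ e s' τ + δ + h * (g s' δ τ).toReal := by
  have hgtop : g s' δ τ ≠ ⊤ := ne_top_of_le_ne_top ENNReal.ofReal_ne_top (ray_g_le hWle he hg hδ)
  have key : ENNReal.ofReal ((e s' (τ + h) - e s' τ - δ) / h) ≤ g s' δ τ := by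
    rw [hg]
    refine le_iInf₂ fun Φ hΦ => ?_
    rw [← ENNReal.ofReal_toReal (ne_top_of_le_ne_top ENNReal.ofReal_ne_top (hWle Φ))]
    refine ENNReal.ofReal_le_ofReal ?_
    rw [div_le_iff₀ hh]
    have h1 := ray_e_le he hb (s' := s') (τ + h) Φ
    rw [hF, max_eq_left (by linarith : 0 ≤ τ + h)] at h1
    rw [hF, max_eq_left hτ] at hΦ
    linarith
  have h2 := (ENNReal.ofReal_le_iff_le_toReal hgtop).1 key
  rw [div_le_iff₀ hh] at h2
  linarith

omit hWm in
/-- LOWER one-step bound `e(τ) + h g(δ, τ) ≤ e(τ + h)` if `h g(δ, τ) ≤ δ` (a state is `δ`-near-minimal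
at `τ` or pays `δ`). [folklore] -/
theorem ray_lower_step {τ h δ : ℝ} (hτ : 0 ≤ τ) (hh : 0 < h) (hsm : h * (g s' δ τ).toReal ≤ δ) :
    e s' τ + h * (g s' δ τ).toReal ≤ e s' (τ + h) := by
  refine ray_le_e he fun Φ => ?_
  have hWt : W Φ ≠ ⊤ := ne_top_of_le_ne_top ENNReal.ofReal_ne_top (hWle Φ)
  have hFh : F (τ + h) s' Φ = F τ s' Φ + h * (W Φ).toReal := by
    rw [hF, hF, max_eq_left hτ, max_eq_left (by linarith)]; ring
  rw [hFh]
  by_cases hΦ : F τ s' Φ ≤ e s' τ + δ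
  · have h1 : (g s' δ τ).toReal ≤ (W Φ).toReal :=
      ENNReal.toReal_mono hWt (by rw [hg]; exact iInf₂_le Φ hΦ)
    nlinarith [ray_e_le he hb (s' := s') τ Φ, mul_le_mul_of_nonneg_left h1 hh.le]
  · push Not at hΦ
    nlinarith [mul_nonneg hh.le (ENNReal.toReal_nonneg (a := W Φ))]

/-- DINI STEP: if the source does not lower the limiting near-minimiser interaction at `τ`
(`⨆_δ g(0, δ, τ) ≤ ⨆_δ g(s, δ, τ)`), then `D = e(0, ·) - e(s, ·)` has `slope D τ z < r` frequently as
`z → τ⁺`, for every `r > 0` (upper step at `s' = 0` with `δ = h²`, lower step at `s' = s`). [folklore] -/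
theorem ray_dini {s τ : ℝ} (hτ : 0 ≤ τ)
    (hG : ⨆ (δ : ℝ) (_ : 0 < δ), g 0 δ τ ≤ ⨆ (δ : ℝ) (_ : 0 < δ), g s δ τ) {r : ℝ} (hr : 0 < r) :
    ∃ᶠ z in 𝓝[>] τ, slope (fun x => e 0 x - e s x) τ z < r := by
  have hGs_ne : (⨆ (δ : ℝ) (_ : 0 < δ), g s δ τ) ≠ ⊤ :=
    ne_top_of_le_ne_top ENNReal.ofReal_ne_top (iSup₂_le fun δ hδ => ray_g_le hWle he hg hδ)
  have hG0_ne : (⨆ (δ : ℝ) (_ : 0 < δ), g 0 δ τ) ≠ ⊤ := ne_top_of_le_ne_top hGs_ne hG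
  have hG0_le := ENNReal.toReal_mono hGs_ne hG
  -- a level `δ'` with `G(0, τ) ≤ g(s, δ', τ) + r/3`
  obtain ⟨δ', hδ', hGg⟩ : ∃ δ' : ℝ, 0 < δ' ∧
      (⨆ (δ : ℝ) (_ : 0 < δ), g 0 δ τ).toReal ≤ (g s δ' τ).toReal + r / 3 := by
    by_cases hsm : (⨆ (δ : ℝ) (_ : 0 < δ), g s δ τ).toReal < r / 3
    · exact ⟨1, one_pos, by linarith [ENNReal.toReal_nonneg (a := g s 1 τ)]⟩
    · push Not at hsm
      have ha : 0 ≤ (⨆ (δ : ℝ) (_ : 0 < δ), g s δ τ).toReal - r / 3 := by linarith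
      obtain ⟨δ', hδ'⟩ := lt_iSup_iff.1 ((ENNReal.ofReal_lt_iff_lt_toReal ha hGs_ne).2 (by linarith))
      obtain ⟨hpos, hlt⟩ := lt_iSup_iff.1 hδ'
      have hgtop : g s δ' τ ≠ ⊤ :=
        ne_top_of_le_ne_top ENNReal.ofReal_ne_top (ray_g_le hWle he hg hpos)
      exact ⟨δ', hpos, by linarith [(ENNReal.ofReal_lt_iff_lt_toReal ha hgtop).1 hlt]⟩
  have hgs_le : (g s δ' τ).toReal ≤ Wm :=
    ENNReal.toReal_le_of_le_ofReal hWm (ray_g_le hWle he hg hδ')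
  -- the slope bound on the right neighbourhood `(τ, τ + h₀)`, `h₀ = min (r/3) (δ'/(Wmax+1))`
  have hmem : Ioo τ (τ + min (r / 3) (δ' / (Wm + 1))) ∈ 𝓝[>] τ :=
    Ioo_mem_nhdsGT (by have := lt_min (by positivity : 0 < r / 3) (by positivity : 0 < δ' / (Wm + 1)); linarith)
  refine (Filter.eventually_of_mem hmem fun z hz => ?_).frequently
  have hh : 0 < z - τ := sub_pos.2 hz.1
  have hhr : z - τ < r / 3 := by linarith [min_le_left (r / 3) (δ' / (Wm + 1)), hz.2]
  have hhδ : z - τ ≤ δ' / (Wm + 1) := by linarith [min_le_right (r / 3) (δ' / (Wm + 1)), hz.2]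
  have hsmall : (z - τ) * (g s δ' τ).toReal ≤ δ' :=
    calc (z - τ) * (g s δ' τ).toReal ≤ δ' / (Wm + 1) * Wm :=
          mul_le_mul hhδ hgs_le ENNReal.toReal_nonneg (by positivity)
      _ ≤ δ' := by rw [div_mul_eq_mul_div, div_le_iff₀ (by positivity)]; nlinarith
  have up := ray_upper_step hWle hF he hg hb (s' := 0) hτ hh (δ := (z - τ) ^ 2) (by positivity)
  have low := ray_lower_step hWle hF he hg hb hτ hh hsmall
  rw [show τ + (z - τ) = z by ring] at up low
  have hg0 : (g 0 ((z - τ) ^ 2) τ).toReal ≤ (g s δ' τ).toReal + r / 3 :=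
    (ENNReal.toReal_mono hG0_ne (le_iSup₂_of_le ((z - τ) ^ 2) (by positivity) le_rfl)).trans hGg
  rw [slope_def_field, div_lt_iff₀ hh]
  nlinarith [mul_le_mul_of_nonneg_left hg0 hh.le, show (z - τ) ^ 2 < (z - τ) * (r / 3) by nlinarith]

/-- TRANSPORT: the sign at every `τ ∈ (0, 1)` gives `D(1) ≤ D(ε)` for `ε ∈ (0, 1)` (continuity, the
Dini step and `image_le_of_liminf_slope_right_le_deriv_boundary` with a constant bound), and `ε → 0⁺`
gives `e(0, 1) - e(s, 1) ≤ e(0, 0) - e(s, 0)`. [folklore] -/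
theorem ray_transport {s : ℝ} (hG : ∀ τ : ℝ, 0 < τ → τ < 1 →
      ⨆ (δ : ℝ) (_ : 0 < δ), g 0 δ τ ≤ ⨆ (δ : ℝ) (_ : 0 < δ), g s δ τ) :
    e 0 1 - e s 1 ≤ e 0 0 - e s 0 := by
  have hcont : ContinuousOn (fun x => e 0 x - e s x) (Ici 0) :=
    (ray_continuousOn hWle hWm hF he hb 0).sub (ray_continuousOn hWle hWm hF he hb s)
  have hDε : ∀ ε : ℝ, 0 < ε → ε < 1 → e 0 1 - e s 1 ≤ e 0 ε - e s ε := fun ε hε hε1 =>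
    image_le_of_liminf_slope_right_le_deriv_boundary (f := fun x => e 0 x - e s x) (a := ε) (b := 1)
      (hcont.mono fun x hx => hε.le.trans hx.1) (B := fun _ => e 0 ε - e s ε) (B' := fun _ => 0)
      le_rfl continuousOn_const (fun x _ => hasDerivWithinAt_const x (Ici x) (e 0 ε - e s ε))
      (fun x hx _ hr => ray_dini hWle hWm hF he hg hb (hε.le.trans hx.1)
        (hG x (hε.trans_le hx.1) hx.2) hr)
      (right_mem_Icc.2 hε1.le)
  -- `ε → 0⁺` by continuity at `0`
  exact ge_of_tendsto ((hcont 0 Set.self_mem_Ici).mono Ioi_subset_Ici_self)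
    (Filter.eventually_of_mem (Ioo_mem_nhdsGT one_pos) fun ε hε => hDε ε hε.1 hε.2)

end Ray

/-! ### §Concrete: bounded admissible potentials, the coupling ray is affine -/

section Concrete

variable {N m : ℕ} {L : ℝ} {w : ℝ → ℝ≥0∞} {n : Fin 3 → ℤ} {Wm : ℝ}

/-- **Uniform bound on the interaction functional**: for a bounded finite-range `w` and `L > 0`,
`W_w(Φ) ≤ #pairs · sup w^per =: Wmax < ∞` for every trial state (`∫|Φ|² = 1`). [folklore] -/
theorem exists_interactionEnergy_le (hw : IsRepulsiveFiniteRange w)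
    (hB : ∃ B : ℝ, ∀ r, w r ≤ ENNReal.ofReal B) (hL : 0 < L) (N : ℕ) :
    ∃ Wm : ℝ, 0 ≤ Wm ∧ ∀ Φ : PeriodicTrialState N L, interactionEnergy w Φ ≤ ENNReal.ofReal Wm := by
  obtain ⟨B, hB⟩ := hB
  obtain ⟨_, R₀, hR₀⟩ := hw
  obtain ⟨Cp, hCp⟩ := exists_bound_periodizedPotential hL (M := B.toNNReal) (fun r => hB r) hR₀
  set K : ℝ≥0∞ := ∑ i : Fin N, ∑ j ∈ Finset.univ.filter (fun j : Fin N => i < j), (Cp : ℝ≥0∞)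
  have hK : K ≠ ⊤ := ENNReal.sum_ne_top.2 fun _ _ => ENNReal.sum_ne_top.2 fun _ _ => ENNReal.coe_ne_top
  refine ⟨K.toReal, ENNReal.toReal_nonneg, fun Φ => ?_⟩
  rw [ENNReal.ofReal_toReal hK]
  unfold interactionEnergy
  calc ∫⁻ X in cellN N L, periodicInteraction w L X * (‖Φ.ψ X‖₊ : ℝ≥0∞) ^ 2
      ≤ ∫⁻ X in cellN N L, K * (‖Φ.ψ X‖₊ : ℝ≥0∞) ^ 2 := lintegral_mono fun X =>
        mul_le_mul' (Finset.sum_le_sum fun i _ => Finset.sum_le_sum fun j _ => hCp _) le_rfl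
    _ = K := by rw [lintegral_const_mul' _ _ hK, Φ.norm_eq, mul_one]

/-- Every periodic trial state has finite free (kinetic) energy. [folklore] -/
theorem periodicEnergy_free_ne_top (Φ : PeriodicTrialState N L) : periodicEnergy 0 Φ ≠ ⊤ := by
  unfold periodicEnergy
  simp only [periodicInteraction_zero, zero_mul, add_zero, lintegral_kineticDensity_eq Φ.contDiff]
  exact ENNReal.ofReal_ne_top

/-- `1 • w = w`. [folklore] -/
theorem scalePot_one (w : ℝ → ℝ≥0∞) : scalePot 1 w = w := by funext r; simp [scalePot]

/-- `0 • w = 0`. [folklore] -/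
theorem scalePot_zero (w : ℝ → ℝ≥0∞) : scalePot 0 w = 0 := by funext r; simp [scalePot]

/-- The periodic interaction is linear along the ray: `∑ (τ•w)^per = τ ∑ w^per`. [folklore] -/
theorem periodicInteraction_scalePot (τ : ℝ) (w : ℝ → ℝ≥0∞) (L : ℝ) (X : Config N) :
    periodicInteraction (scalePot τ w) L X = ENNReal.ofReal τ * periodicInteraction w L X := by
  unfold periodicInteraction periodizedPotential scalePot
  simp_rw [ENNReal.tsum_mul_left, Finset.mul_sum]

/-- The interaction functional is linear along the ray: `W_{τ•w} = τ W_w`. [folklore] -/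
theorem interactionEnergy_scalePot (τ : ℝ) (w : ℝ → ℝ≥0∞) (Φ : PeriodicTrialState N L) :
    interactionEnergy (scalePot τ w) Φ = ENNReal.ofReal τ * interactionEnergy w Φ := by
  unfold interactionEnergy
  simp_rw [periodicInteraction_scalePot, mul_assoc]
  exact lintegral_const_mul' _ _ ENNReal.ofReal_ne_top

/-- **The energy is affine along the ray**: `E_{τ•w}(Φ) = E_0(Φ) + τ W_w(Φ)`. [folklore] -/
theorem periodicEnergy_scalePot (τ : ℝ) (w : ℝ → ℝ≥0∞) (Φ : PeriodicTrialState N L) :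
    periodicEnergy (scalePot τ w) Φ = periodicEnergy 0 Φ + ENNReal.ofReal τ * interactionEnergy w Φ := by
  have hmeas : Measurable (kineticDensity Φ.ψ) := by
    rw [show kineticDensity Φ.ψ = fun X => ENNReal.ofReal (kineticDensityReal Φ.ψ X) from
      funext (kineticDensity_eq_ofReal Φ.ψ)]
    exact ENNReal.measurable_ofReal.comp (continuous_kineticDensityReal Φ.contDiff).measurable
  unfold periodicEnergy interactionEnergy
  rw [lintegral_add_left hmeas]
  simp_rw [periodicInteraction_zero, zero_mul, add_zero, periodicInteraction_scalePot, mul_assoc]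
  rw [lintegral_const_mul' _ _ ENNReal.ofReal_ne_top]

/-- Finite energies along the ray of a bounded potential. [folklore] -/
theorem periodicEnergy_scalePot_ne_top
    (hW : ∀ Φ : PeriodicTrialState N L, interactionEnergy w Φ ≤ ENNReal.ofReal Wm) (τ : ℝ)
    (Φ : PeriodicTrialState N L) : periodicEnergy (scalePot τ w) Φ ≠ ⊤ := by
  rw [periodicEnergy_scalePot]
  exact ENNReal.add_ne_top.2 ⟨periodicEnergy_free_ne_top Φ, ENNReal.mul_ne_top ENNReal.ofReal_ne_top
    (ne_top_of_le_ne_top ENNReal.ofReal_ne_top (hW Φ))⟩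

/-- **The sourced functional along the ray**: `F_{τ•w, s}(Φ) = T(Φ) + τ⁺ W(Φ) - s·2N|I(Φ)|`. [folklore] -/
theorem sourcedFunctional_scalePot
    (hW : ∀ Φ : PeriodicTrialState (m + 1) L, interactionEnergy w Φ ≤ ENNReal.ofReal Wm)
    (τ s' : ℝ) (Φ : PeriodicTrialState (m + 1) L) :
    sourcedFunctional (scalePot τ w) m L n s' Φ = (periodicEnergy 0 Φ).toReal +
      max τ 0 * (interactionEnergy w Φ).toReal - s' * (2 * (m + 1) * ‖sourceIntegral m L n Φ.ψ‖) := by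
  have hWt : interactionEnergy w Φ ≠ ⊤ := ne_top_of_le_ne_top ENNReal.ofReal_ne_top (hW Φ)
  unfold sourcedFunctional
  rw [periodicEnergy_scalePot, ENNReal.toReal_add (periodicEnergy_free_ne_top Φ)
    (ENNReal.mul_ne_top ENNReal.ofReal_ne_top hWt), ENNReal.toReal_mul, ENNReal.toReal_ofReal']

/-- **The ground-state interaction along the ray**, `τ > 0` pulled out: near-minimisers are the states
within `δ` of the infimum `e` (all energies are finite), so `groundInteraction (τ•w) s = τ ⨆_{δ>0} g(δ)`,
`g(δ) = inf {W_w(Φ) : F_τ(Φ) ≤ e + δ}`. [folklore] -/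
theorem groundInteraction_scalePot_eq
    (hW : ∀ Φ : PeriodicTrialState (m + 1) L, interactionEnergy w Φ ≤ ENNReal.ofReal Wm)
    {τ s' e : ℝ} (hτ : 0 < τ) (he : e = ⨅ Φ, sourcedFunctional (scalePot τ w) m L n s' Φ)
    (hbdd : BddBelow (Set.range fun Φ : PeriodicTrialState (m + 1) L =>
      sourcedFunctional (scalePot τ w) m L n s' Φ))
    {gτ : ℝ → ℝ≥0∞} (hg : ∀ δ, gτ δ = ⨅ (Φ : PeriodicTrialState (m + 1) L)
      (_ : sourcedFunctional (scalePot τ w) m L n s' Φ ≤ e + δ), interactionEnergy w Φ) :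
    groundInteraction (scalePot τ w) m L n s' = ENNReal.ofReal τ * ⨆ (δ : ℝ) (_ : 0 < δ), gτ δ := by
  have hiff : ∀ δ Φ, IsSourcedNearMin (scalePot τ w) m L n s' δ Φ ↔
      sourcedFunctional (scalePot τ w) m L n s' Φ ≤ e + δ := fun δ Φ => by
    refine ⟨fun ⟨_, h⟩ => ?_, fun h => ⟨periodicEnergy_scalePot_ne_top hW τ Φ, fun Φ' _ => ?_⟩⟩
    · haveI : Nonempty (PeriodicTrialState (m + 1) L) := ⟨Φ⟩
      have h1 : sourcedFunctional (scalePot τ w) m L n s' Φ - δ ≤ e :=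
        he ▸ le_ciInf fun Φ' => by linarith [h Φ' (periodicEnergy_scalePot_ne_top hW τ Φ')]
      linarith
    · linarith [show e ≤ sourcedFunctional (scalePot τ w) m L n s' Φ' from he ▸ ciInf_le hbdd Φ']
  unfold groundInteraction
  simp_rw [hg, hiff, interactionEnergy_scalePot, ENNReal.mul_iSup,
    ENNReal.mul_iInf_of_ne (ENNReal.ofReal_pos.2 hτ).ne' ENNReal.ofReal_ne_top]

/-- **The free chord bounds the sourced functional below along the ray**: `E₀(0) - C s² L²/‖n‖² ≤
F_{τ•w, s}(Φ)` (`GDIneq 0` in real terms and `W ≥ 0` for `s ≥ 0`; the variational principle for `s < 0`).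
[folklore] -/
theorem sourcedFunctional_ge_of_free
    (hW : ∀ Φ : PeriodicTrialState (m + 1) L, interactionEnergy w Φ ≤ ENNReal.ofReal Wm) {C : ℝ}
    (hC : 0 ≤ C) (hfree : GDChordBody 0 C m L n) (s' τ : ℝ) (Φ : PeriodicTrialState (m + 1) L) :
    (periodicGroundStateEnergy 0 (m + 1) L).toReal - C * s' ^ 2 * L ^ 2 / ‖(fun j => (n j : ℝ))‖ ^ 2 ≤
      sourcedFunctional (scalePot τ w) m L n s' Φ := by
  have hT := periodicEnergy_free_ne_top Φ
  have hK : 0 ≤ C * s' ^ 2 * L ^ 2 / ‖(fun j => (n j : ℝ))‖ ^ 2 := by positivity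
  have hω : 0 ≤ max τ 0 * (interactionEnergy w Φ).toReal :=
    mul_nonneg (le_max_right _ _) ENNReal.toReal_nonneg
  rw [sourcedFunctional_scalePot hW]
  rcases le_or_gt 0 s' with hs' | hs'
  · have h := hfree s' hs' Φ
    unfold GDIneq at h
    have hE0 : periodicGroundStateEnergy 0 (m + 1) L ≠ ⊤ :=
      ne_top_of_le_ne_top hT (periodicGroundStateEnergy_le 0 Φ)
    have hJ : 0 ≤ s' * (2 * (m + 1) * ‖sourceIntegral m L n Φ.ψ‖) := by positivity
    have h' := ENNReal.toReal_mono (ENNReal.add_ne_top.2 ⟨hT, ENNReal.ofReal_ne_top⟩) h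
    rw [ENNReal.toReal_add hE0 ENNReal.ofReal_ne_top, ENNReal.toReal_add hT ENNReal.ofReal_ne_top,
      ENNReal.toReal_ofReal hJ, ENNReal.toReal_ofReal hK] at h'
    linarith
  · have h1 := ENNReal.toReal_mono hT (periodicGroundStateEnergy_le 0 Φ)
    have hJ : 0 ≤ 2 * ((m : ℝ) + 1) * ‖sourceIntegral m L n Φ.ψ‖ := by positivity
    nlinarith

end Concrete

/-- **Registered stub C `stub_chordTransport`** (line `coupling-monotone-chord`, crux
stmt-AtomisticToContinuum-9479): along the coupling ray `τ ↦ τ • w` of a bounded admissible potential,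
if the source never lowers the ground-state interaction energy at any `τ ∈ (0, 1]`, every chord constant
valid for the free gas at `(m, L, n)` is valid for `w`.  Variational Hellmann–Feynman (`ray_transport`)
applied to `F(τ, s, Φ) = sourcedFunctional (τ•w) … s Φ`, whose ends are `e(0, 1) = E₀(w)`,
`e(0, 0) = E₀(0)`, `e(s, 0) ≥ E₀(0) - C s² L²/‖n‖²`, `e(s, 1) ≤ E_w(Φ) - s·2N|I(Φ)|`. [folklore] -/
theorem stub_chordTransport : ChordTransport := by
  intro w hw hB m L hL n _hn hSRI C hC hfree s hs Φ₀
  have hc : ((Real.sqrt (L ^ 3))⁻¹) ^ 2 * L ^ 3 = 1 := by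
    rw [inv_pow, Real.sq_sqrt (by positivity), inv_mul_cancel₀ (by positivity)]
  haveI : Nonempty (PeriodicTrialState (m + 1) L) := ⟨constState m hL _ hc⟩
  obtain ⟨Wm, hWm, hW⟩ := exists_interactionEnergy_le hw hB hL (m + 1)
  -- the real objects of the ray analysis
  set F : ℝ → ℝ → PeriodicTrialState (m + 1) L → ℝ :=
    fun τ s' Φ => sourcedFunctional (scalePot τ w) m L n s' Φ with hFdef
  obtain ⟨e, he⟩ : ∃ e : ℝ → ℝ → ℝ, ∀ s' τ, e s' τ = ⨅ Φ, F τ s' Φ := ⟨_, fun _ _ => rfl⟩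
  obtain ⟨g, hg⟩ : ∃ g : ℝ → ℝ → ℝ → ℝ≥0∞, ∀ s' δ τ, g s' δ τ =
      ⨅ (Φ : PeriodicTrialState (m + 1) L) (_ : F τ s' Φ ≤ e s' τ + δ), interactionEnergy w Φ :=
    ⟨_, fun _ _ _ => rfl⟩
  have hF : ∀ τ s' Φ, F τ s' Φ = (periodicEnergy 0 Φ).toReal + max τ 0 * (interactionEnergy w Φ).toReal
      - s' * (2 * (m + 1) * ‖sourceIntegral m L n Φ.ψ‖) := fun τ s' Φ => sourcedFunctional_scalePot hW τ s' Φ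
  -- the lower bound from the free chord
  have hb : ∀ s' τ Φ, (periodicGroundStateEnergy 0 (m + 1) L).toReal -
      C * s' ^ 2 * L ^ 2 / ‖(fun j => (n j : ℝ))‖ ^ 2 ≤ F τ s' Φ :=
    fun s' τ Φ => sourcedFunctional_ge_of_free hW hC.le hfree s' τ Φ
  have hbdd : ∀ s' τ, BddBelow (Set.range fun Φ : PeriodicTrialState (m + 1) L =>
      sourcedFunctional (scalePot τ w) m L n s' Φ) := fun s' τ => ⟨_, Set.forall_mem_range.2 (hb s' τ)⟩
  -- the sign hypothesis with `τ > 0` cancelled: `G(0, τ) ≤ G(s, τ)`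
  have hG : ∀ τ : ℝ, 0 < τ → τ < 1 →
      ⨆ (δ : ℝ) (_ : 0 < δ), g 0 δ τ ≤ ⨆ (δ : ℝ) (_ : 0 < δ), g s δ τ := by
    intro τ hτ hτ1
    have h := hSRI τ hτ hτ1.le s hs
    rw [groundInteraction_scalePot_eq hW hτ (he 0 τ) (hbdd 0 τ) fun δ => hg 0 δ τ,
      groundInteraction_scalePot_eq hW hτ (he s τ) (hbdd s τ) fun δ => hg s δ τ] at h
    exact (ENNReal.mul_le_mul_iff_right (ENNReal.ofReal_pos.2 hτ).ne' ENNReal.ofReal_ne_top).1 h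
  -- transport along the ray: `D(1) ≤ D(0)`
  have hD := ray_transport hW hWm hF he hg hb hG
  -- the two ends of the ray
  have hinf : ∀ τ, ⨅ Φ, F τ 0 Φ = (periodicGroundStateEnergy (scalePot τ w) (m + 1) L).toReal := fun τ => by
    unfold periodicGroundStateEnergy
    rw [ENNReal.toReal_iInf (periodicEnergy_scalePot_ne_top hW τ)]
    exact iInf_congr fun Φ => by simp [hFdef, sourcedFunctional]
  have he00 : e 0 0 = (periodicGroundStateEnergy 0 (m + 1) L).toReal := by rw [he, hinf 0, scalePot_zero]
  have he01 : e 0 1 = (periodicGroundStateEnergy w (m + 1) L).toReal := by rw [he, hinf 1, scalePot_one]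
  have hes0 : (periodicGroundStateEnergy 0 (m + 1) L).toReal -
      C * s ^ 2 * L ^ 2 / ‖(fun j => (n j : ℝ))‖ ^ 2 ≤ e s 0 := ray_le_e he (hb s 0)
  have hes1 : e s 1 ≤ (periodicEnergy w Φ₀).toReal - s * (2 * (m + 1) * ‖sourceIntegral m L n Φ₀.ψ‖) := by
    simpa only [hFdef, scalePot_one, sourcedFunctional] using ray_e_le he hb (s' := s) 1 Φ₀
  -- back to `ℝ≥0∞`
  have hTw : periodicEnergy w Φ₀ ≠ ⊤ := by simpa only [scalePot_one] using periodicEnergy_scalePot_ne_top hW 1 Φ₀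
  have hE0w : periodicGroundStateEnergy w (m + 1) L ≠ ⊤ :=
    ne_top_of_le_ne_top hTw (periodicGroundStateEnergy_le w Φ₀)
  have hJ : 0 ≤ s * (2 * (m + 1) * ‖sourceIntegral m L n Φ₀.ψ‖) := by positivity
  have hK : 0 ≤ C * s ^ 2 * L ^ 2 / ‖(fun j => (n j : ℝ))‖ ^ 2 := by positivity
  unfold GDIneq
  rw [← ENNReal.ofReal_toReal hE0w, ← ENNReal.ofReal_toReal hTw,
    ← ENNReal.ofReal_add ENNReal.toReal_nonneg hJ, ← ENNReal.ofReal_add ENNReal.toReal_nonneg hK]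
  exact ENNReal.ofReal_le_ofReal (by linarith)

end Summit.AtomisticToContinuum.BoseEinsteinCondensation.Cruxes.GaussianDominationCan.CouplingMonotoneChord

end
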